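import Summits.Ventures.HSemireg.WedgeApolarClosedForm
import Summits.Ventures.HSemireg.WedgeApolarSiegelWindowCharP

/-!
# Venture HSemireg — THE RADICAL OF THE APOLAR PAIRING IS THE SPACE OF SIEGEL CLASSES: `q ⊥ everything ⇔ C(n,j)·q_j = 0 for all j ⇔ w_n(q) ∈ SI_n ⇔ w_n(q) ∧ w_n(q′) = 0
# for all q′`; the pairing is NON-DEGENERATE iff every `C(n,j)` is a unit in `K` (I15's sufficient condition is sharp) — always in characteristic `0` or `p > n`, never for
# `n = p^e` in characteristic `p`, where the radical is `{q : q_0 = q_{p^e} = 0}` of codimension `2`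

HONEST FRAMING. Part of the Lean index of the computation cell `pub-hsemireg` (seat p10 gen 20, Sunday typer «UNIFORM-IN-n»).
Finite-dimensional EXTERIOR ALGEBRA + linear algebra + binomial arithmetic ONLY: no variety, no cohomology theory, no sheaf, no Ext group, no semiregularity map;
nothing here says that HC / HC_CM / HC_AV holds; no Literature fact is declared or used.  Custodian versions as in `WedgeHankelSiegelIdeal` (1/3) and `WedgeHankelCoSiegel`;
the dictionary (the apolar pairing = the `n`-th transvectant of two binary forms; its radical in characteristic `p` = the forms all of whose `GL₂`-relevant coefficients die) is QUOTED.

WHAT IS IN THE TREE.  I14 (`WedgeApolarPairing`): `w_n(q) ∧ w_n(q′) = apolar_n(q,q′)·vol`, `w_mul_w_eq_zero_iff`, `w_mem_Kr_w_top_iff`, `apolar_swap`; I15 (`WedgeApolarSpikes`):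
`apolar_spike_right`, `apolar_nondegenerate` (units ⇒ non-degenerate); I17 (`WedgeApolarClosedForm`): `apolar_eq_sum` (the closed form); I19 (`WedgeApolarSiegelWindow`):
`w_mem_siegelIdeal_iff` (`w_n(q) ∈ SI_n ⇔ C(n,j)·q_j = 0`); J2 (`WedgeApolarSiegelWindowCharP`): the characteristic readings of `C(n,j) = 0`.  THIS FILE (namespace
`Summit.Ventures.HSemireg.Wedge.KernelDuality` continued; imports I17, J2) identifies the RADICAL of the pairing with those statements:
* §236 **`apolar_left_radical_iff`: `(∀ q′, apolar_m(q, q′) = 0) ⇔ ∀ j ≤ m, C(m,j)·q_j = 0`** (every field, every `m`; `→` by pairing with the spikes, `←` by I17's closed form),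
  `apolar_right_radical_iff` (the same on the right, `apolar_swap`).
* §237 `m = n`: **`apolar_radical_iff_w_mem_siegelIdeal`** (`q` is in the radical iff `w_n(q)` is a Siegel form), **`forall_w_mul_w_eq_zero_iff_mem_siegelIdeal`** (`w_n(q) ∧ w_n(q′) = 0` for
  all `q′` iff `w_n(q) ∈ SI_n`), `w_mem_siegelIdeal_iff_forall_w_mem_Kr` (iff every class lies in the degree-`n` kernel of `w_n(q)`).
* §238 **`apolar_nondegenerate_iff`: the apolar pairing of degree `m` is non-degenerate iff every `C(m,j)`, `j ≤ m`, is non-zero in `K`** (I15 is sharp), hence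
  `apolar_nondegenerate_of_charZero`, `apolar_nondegenerate_of_lt_char` (`m < p`), and **`apolar_left_radical_iff_prime_pow`** (`m = p^e` in characteristic `p`: the radical is
  `{q : q_0 = 0 ∧ q_{p^e} = 0}` — only the two extreme coefficients pair), `apolar_degenerate_prime_pow` (`e ≥ 1`: degenerate).
NOT typed here: the rank `Π_i (m_i + 1)` of the pairing in characteristic `p` (Lucas digits `m_i`; J2 types the digit criterion, not the product); anything Ext-side.  New names only.
-/

open Module

namespace Summit.Ventures.HSemireg.Wedge.KernelDuality

open Summit.Ventures.HSemireg.Wedge Summit.Ventures.HSemireg.Wedge.Kunneth Summit.Ventures.HSemireg.Wedge.Hankel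
  Summit.Ventures.HSemireg.Wedge.BasisFree Summit.Ventures.HSemireg.Wedge.HankelSiegel Summit.Ventures.HSemireg.Wedge.HankelSiegelIdeal
  Summit.Ventures.HSemireg.Wedge.KunnethKernel Summit.Ventures.HSemireg.Wedge.HankelRankOne Summit.Ventures.HSemireg.Wedge.HankelFrameChange

variable (K : Type*) [Field K] {n : ℕ}

/-! ## §236. The radical of the apolar pairing in coordinates -/

/-- **THE LEFT RADICAL: `(∀ q′, apolar_m(q, q′) = 0) ⇔ ∀ j ≤ m, C(m,j)·q_j = 0`** (every field, every `m`): pairing with the spike `δ_{m−j}` isolates `± C(m,j)·q_j` (I15), and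
I17's closed form `apolar_m(q,q′) = ± Σ_p (−1)^p C(m,p) q_p q′_{m−p}` vanishes termwise in the other direction. -/
theorem apolar_left_radical_iff (m : ℕ) (q : ℕ → K) : (∀ q' : ℕ → K, apolar K m q q' = 0) ↔ ∀ j ≤ m, (m.choose j : K) * q j = 0 := by
  constructor
  · intro h j hj
    have h1 := h (fun i => if i = m - j then (1 : K) else 0)
    rw [apolar_spike_right K m q (Nat.sub_le m j), Nat.sub_sub_self hj] at h1
    have hu : (-1 : K) ^ (m * (m - 1) / 2) * (-1) ^ j ≠ 0 :=
      mul_ne_zero (pow_ne_zero _ (neg_ne_zero.mpr one_ne_zero)) (pow_ne_zero _ (neg_ne_zero.mpr one_ne_zero))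
    have e : (-1 : K) ^ (m * (m - 1) / 2) * (-1) ^ j * ((m.choose j : K) * q j) = 0 := by rw [← h1]; ring
    exact (mul_eq_zero.mp e).resolve_left hu
  · intro h q'
    rw [apolar_eq_sum]
    refine mul_eq_zero_of_right _ (Finset.sum_eq_zero fun p hp => ?_)
    rw [mul_assoc ((-1 : K) ^ p), h p (Nat.lt_succ_iff.mp (Finset.mem_range.mp hp)), mul_zero, zero_mul]

/-- **THE RIGHT RADICAL: `(∀ q, apolar_m(q, q′) = 0) ⇔ ∀ j ≤ m, C(m,j)·q′_j = 0`** (`apolar_swap`: the pairing is `(−1)^m`-symmetric). -/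
theorem apolar_right_radical_iff (m : ℕ) (q' : ℕ → K) : (∀ q : ℕ → K, apolar K m q q' = 0) ↔ ∀ j ≤ m, (m.choose j : K) * q' j = 0 := by
  rw [← apolar_left_radical_iff]
  have hu : (-1 : K) ^ m ≠ 0 := pow_ne_zero _ (neg_ne_zero.mpr one_ne_zero)
  constructor
  · intro h q
    have e := apolar_swap K m q' q
    rw [h q] at e
    exact (mul_eq_zero.mp e.symm).resolve_left hu
  · intro h q
    rw [apolar_swap, h q, mul_zero]

/-! ## §237. The radical is the space of Siegel classes -/

/-- **`q` IS IN THE RADICAL OF THE APOLAR PAIRING IFF `w_n(q)` IS A SIEGEL FORM** (I19 `w_mem_siegelIdeal_iff`). -/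
theorem apolar_radical_iff_w_mem_siegelIdeal (q : ℕ → K) : (∀ q' : ℕ → K, apolar K n q q' = 0) ↔ w K n n q ∈ siegelIdeal K n n := by
  rw [apolar_left_radical_iff, w_mem_siegelIdeal_iff]

/-- **`w_n(q) ∧ w_n(q′) = 0` FOR EVERY `q′` IFF `w_n(q) ∈ SI_n`**: a class is killed by all classes exactly when it is a Siegel form (I14 `w_mul_w_eq_zero_iff`). -/
theorem forall_w_mul_w_eq_zero_iff_mem_siegelIdeal (q : ℕ → K) : (∀ q' : ℕ → K, w K n n q * w K n n q' = 0) ↔ w K n n q ∈ siegelIdeal K n n := by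
  rw [← apolar_radical_iff_w_mem_siegelIdeal]
  exact forall_congr' fun q' => w_mul_w_eq_zero_iff K q q'

/-- `w_n(q) ∈ SI_n` iff EVERY class `w_n(q′)` lies in the degree-`n` kernel `Kr(univ, w_n q, n)` (I14 `w_mem_Kr_w_top_iff`, right radical). -/
theorem w_mem_siegelIdeal_iff_forall_w_mem_Kr (q : ℕ → K) :
    w K n n q ∈ siegelIdeal K n n ↔ ∀ q' : ℕ → K, w K n n q' ∈ Kr K Finset.univ (w K n n q) n := by
  rw [w_mem_siegelIdeal_iff, ← apolar_right_radical_iff]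
  exact forall_congr' fun q' => (w_mem_Kr_w_top_iff K q q').symm

/-! ## §238. Non-degeneracy: I15's criterion is sharp; the characteristic readings -/

/-- **THE APOLAR PAIRING OF DEGREE `m` IS NON-DEGENERATE IFF EVERY `C(m,j)` (`j ≤ m`) IS NON-ZERO IN `K`** (I15 `apolar_nondegenerate` gave `⇐`; for `⇒`, a vanishing binomial
`C(m,j₀) = 0` puts the spike `δ_{j₀}` in the radical). -/
theorem apolar_nondegenerate_iff (m : ℕ) :
    (∀ q : ℕ → K, (∀ q' : ℕ → K, apolar K m q q' = 0) → ∀ j ≤ m, q j = 0) ↔ ∀ j ≤ m, (m.choose j : K) ≠ 0 := by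
  constructor
  · intro h j hj hc
    have hrad : ∀ q' : ℕ → K, apolar K m (fun i => if i = j then (1 : K) else 0) q' = 0 := by
      rw [apolar_left_radical_iff]
      intro i _
      by_cases hij : i = j
      · rw [hij, if_pos rfl, hc, zero_mul]
      · rw [if_neg hij, mul_zero]
    have e := h _ hrad j hj
    rw [if_pos rfl] at e
    exact one_ne_zero e
  · intro hK q hq j hj
    have e := (apolar_left_radical_iff K m q).mp hq j hj
    exact (mul_eq_zero.mp e).resolve_left (hK j hj)

/-- in characteristic `0` the apolar pairing of every degree is non-degenerate. -/
theorem apolar_nondegenerate_of_charZero [CharZero K] (m : ℕ) {q : ℕ → K} (hq : ∀ q' : ℕ → K, apolar K m q q' = 0) : ∀ j ≤ m, q j = 0 :=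
  (apolar_nondegenerate_iff K m).mpr (fun _ hj => Nat.cast_ne_zero.2 (Nat.choose_pos hj).ne') q hq

/-- in characteristic `p > m` the apolar pairing of degree `m` is non-degenerate (J2 `not_prime_dvd_choose_of_lt`). -/
theorem apolar_nondegenerate_of_lt_char (p : ℕ) [CharP K p] (hp : p.Prime) {m : ℕ} (hm : m < p) {q : ℕ → K} (hq : ∀ q' : ℕ → K, apolar K m q q' = 0) :
    ∀ j ≤ m, q j = 0 :=
  (apolar_nondegenerate_iff K m).mpr (fun _ hj hc => not_prime_dvd_choose_of_lt hp hm hj ((CharP.cast_eq_zero_iff K p _).mp hc)) q hq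

/-- **`m = p^e` IN CHARACTERISTIC `p`: THE RADICAL IS `{q : q_0 = 0 ∧ q_{p^e} = 0}`** — only the two extreme coefficients pair (`C(p^e, j) = 0` in `K` exactly for `0 < j < p^e`,
Mathlib `Nat.Prime.dvd_choose_pow_iff`). -/
theorem apolar_left_radical_iff_prime_pow (p : ℕ) [CharP K p] (hp : p.Prime) (e : ℕ) (q : ℕ → K) :
    (∀ q' : ℕ → K, apolar K (p ^ e) q q' = 0) ↔ q 0 = 0 ∧ q (p ^ e) = 0 := by
  rw [apolar_left_radical_iff]
  constructor
  · intro h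
    refine ⟨?_, ?_⟩
    · have h0 := h 0 (Nat.zero_le _)
      rwa [Nat.choose_zero_right, Nat.cast_one, one_mul] at h0
    · have h1 := h (p ^ e) le_rfl
      rwa [Nat.choose_self, Nat.cast_one, one_mul] at h1
  · rintro ⟨h0, htop⟩ j hj
    by_cases hj0 : j = 0
    · rw [hj0, h0, mul_zero]
    by_cases hjt : j = p ^ e
    · rw [hjt, htop, mul_zero]
    · rw [(CharP.cast_eq_zero_iff K p _).mpr (hp.dvd_choose_pow_iff.mpr ⟨hj0, hjt⟩), zero_mul]

/-- hence for `e ≥ 1` the apolar pairing of degree `p^e` is DEGENERATE in characteristic `p`: the spike `δ_1` pairs to zero with everything. -/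
theorem apolar_degenerate_prime_pow (p : ℕ) [CharP K p] (hp : p.Prime) {e : ℕ} (he : 1 ≤ e) :
    ∀ q' : ℕ → K, apolar K (p ^ e) (fun i => if i = 1 then (1 : K) else 0) q' = 0 := by
  rw [apolar_left_radical_iff_prime_pow K p hp e]
  have h1 : 1 < p ^ e := Nat.one_lt_pow (by omega) hp.one_lt
  exact ⟨if_neg (by omega), if_neg (by omega)⟩

end Summit.Ventures.HSemireg.Wedge.KernelDuality
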